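import Summits.Parity.BatemanHorn.Theorems.AlmostPrimeZerosLinearCappedRepulsionShortIntervalCapped
import HarnessLib

/-!
# Crux `DiscMajorantLog` (stmt-Parity-17114), line `Sketch`: stub `stub_shortIntervalWide` —
short sums of the capped majorant `R^{s(n)}` in the wide range `R ≤ 4 log log x`

Notation: `s(n) = Σ_{p^v ∥ n} min(v, 2)` (in Lean `n.factorization.sum fun _ v => min v 2`),
`X = x`, `𝓛 = log X`, `L = log 𝓛`, `h = X e^{−L³}`, `m = ⌊X + h⌋₊`.

Statement: from the Rankin majorant
`Σ_{0 ≤ n ≤ x} y^{s(n)} ≤ (x + 1) exp(B y log log x + B y^{3/2})` (`x ≥ 3`, `y ≥ 1`, taken as a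
hypothesis together with its constant `B ≥ 0`), there is a threshold `x₁` with
`Σ_{x < n ≤ m} R^{s(n)} ≤ X 𝓛^{−R−1}` for all natural `x ≥ x₁` and all `1 ≤ R ≤ 4L`.
This is the elementary de-smoothing step of the Selberg–Delange method
[MontgomeryVaughan2007, §7.4] for the capped statistic, re-run from the landed
`stub_shortIntervalCapped` (range `R ≤ L / C`) of the sibling crux `LinearCappedRepulsion`:
only the split point `K` and the threshold move, the length `h` does not.

Proof: split the sum at `K = ⌈(168B + 6) L²⌉₊`.
* terms with `s(n) ≤ K`: each is `≤ R^K ≤ (L²)^K` (`R ≤ 4L ≤ L²` for `L ≥ 4`), and there are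
  `m − x ≤ h` of them, total `≤ X e^{−L³} (L²)^K = X exp(−L³ + 2K log L)`;
* terms with `s(n) > K`: `R^{s(n)} ≤ e^{−K} (eR)^{s(n)}`, and by the hypothesis at the natural
  `2x ≥ 3` and `y = eR ≥ 1` (note `m ≤ 2x`),
  `Σ_{n ≤ 2x} (eR)^{s(n)} ≤ (2X + 1) exp(B eR log log(2X) + B (eR)^{3/2}) ≤ 3X exp(168 B L²)`
  (`log log (2X) ≤ L + 1 ≤ 2L`, `e < 3`, `eR ≤ 12L`, `(eR)^{3/2} ≤ (eR)² ≤ 144L²`);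
both pieces are `≤ X exp(−4L² − L − 1)` once `L ≥ 4` and `(336B + 14) log L + 5 ≤ L` (true for
all large `L` since `log L = o(L)`), and
`2X exp(−4L² − L − 1) ≤ X exp(−4L² − L) ≤ X exp(−(R + 1)L) = X 𝓛^{−R−1}` because `R ≤ 4L`.
The threshold `x₁` is extracted from `Filter.eventually_atTop` along `log log x → ∞`.
The `R`-independent pieces `shortInterval_low_part`, `shortInterval_high_part`,
`loglog_two_mul_le` are imported from the template file, not re-proved.
-/

noncomputable section

namespace Summit.Parity.BatemanHorn.Cruxes.DiscMajorantLog.Sketch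

open Finset Real Filter
open Summit.Parity.BatemanHorn.Cruxes.LinearCappedRepulsion.JensenStieltjesMajorant
  (shortInterval_low_part shortInterval_high_part loglog_two_mul_le)

namespace ShortIntervalWide

/-- The exponent of the Rankin majorant at `y = eR` and `2X`, wide range: for `X ≥ 2`,
`1 ≤ R ≤ 4L`, `L = log log X ≥ 1`, `B ≥ 0`:
`B (eR) log log (2X) + B (eR)^{3/2} ≤ 168 B L²`. -/
theorem rankin_exponent_le_wide {B X R L : ℝ} (hB : 0 ≤ B) (hX : 2 ≤ X)
    (hL : Real.log (Real.log X) = L) (hL1 : 1 ≤ L) (hR1 : 1 ≤ R) (hRL : R ≤ 4 * L) :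
    B * (Real.exp 1 * R) * Real.log (Real.log (2 * X)) + B * (Real.exp 1 * R) ^ (3 / 2 : ℝ) ≤
      168 * B * L ^ 2 := by
  -- adapted from `JensenStieltjesMajorant.rankin_exponent_le` (range `R ≤ L`, bound `15 B L²`)
  have he3 : Real.exp 1 ≤ 3 := by
    have := Real.exp_one_lt_d9
    norm_num at this ⊢
    linarith
  have he1 : 1 ≤ Real.exp 1 := Real.one_le_exp zero_le_one
  have hR0 : 0 ≤ R := by linarith
  have heR1 : 1 ≤ Real.exp 1 * R := one_le_mul_of_one_le_of_one_le he1 hR1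
  have heR0 : 0 ≤ Real.exp 1 * R := by linarith
  have heR12L : Real.exp 1 * R ≤ 12 * L := by
    have h := mul_le_mul he3 hRL hR0 (by norm_num : (0 : ℝ) ≤ 3)
    linarith
  -- first term
  have h1 : B * (Real.exp 1 * R) * Real.log (Real.log (2 * X)) ≤ 24 * B * L ^ 2 := by
    have hll : Real.log (Real.log (2 * X)) ≤ 2 * L := by
      have := loglog_two_mul_le hX
      rw [hL] at this
      linarith
    calc B * (Real.exp 1 * R) * Real.log (Real.log (2 * X))
        ≤ B * (Real.exp 1 * R) * (2 * L) :=
          mul_le_mul_of_nonneg_left hll (mul_nonneg hB heR0)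
      _ ≤ B * (12 * L) * (2 * L) := by
          apply mul_le_mul_of_nonneg_right _ (by linarith)
          exact mul_le_mul_of_nonneg_left heR12L hB
      _ = 24 * B * L ^ 2 := by ring
  -- second term
  have h2 : B * (Real.exp 1 * R) ^ (3 / 2 : ℝ) ≤ 144 * B * L ^ 2 := by
    have hpow : (Real.exp 1 * R) ^ (3 / 2 : ℝ) ≤ 144 * L ^ 2 := by
      calc (Real.exp 1 * R) ^ (3 / 2 : ℝ) ≤ (Real.exp 1 * R) ^ (2 : ℝ) :=
            Real.rpow_le_rpow_of_exponent_le heR1 (by norm_num)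
        _ = (Real.exp 1 * R) ^ 2 := Real.rpow_two _
        _ ≤ (12 * L) ^ 2 := pow_le_pow_left₀ heR0 heR12L 2
        _ = 144 * L ^ 2 := by ring
    calc B * (Real.exp 1 * R) ^ (3 / 2 : ℝ) ≤ B * (144 * L ^ 2) :=
          mul_le_mul_of_nonneg_left hpow hB
      _ = 144 * B * L ^ 2 := by ring
  linarith

/-- The final numerical step.  With `K = ⌈(168B + 6) L²⌉₊`, `L ≥ 4`, `(336B + 14) log L + 5 ≤ L`,
`R ≤ 4L`, `X ≥ 1` and an exponent `Q ≤ 168 B L²`: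
`X e^{−L³} (L²)^K + e^{−K} (2X + 1) e^{Q} ≤ X exp(L (−R − 1))`. -/
theorem final_wide {B L R X Q : ℝ} {K : ℕ} (hB : 0 ≤ B) (hL4 : 4 ≤ L)
    (hAL : (336 * B + 14) * Real.log L + 5 ≤ L)
    (hKlo : (168 * B + 6) * L ^ 2 ≤ K) (hKhi : (K : ℝ) < (168 * B + 6) * L ^ 2 + 1)
    (hRL : R ≤ 4 * L) (hX : 1 ≤ X) (hQ : Q ≤ 168 * B * L ^ 2) :
    X * Real.exp (-L ^ 3) * (L ^ 2) ^ K + Real.exp (-K) * (2 * X + 1) * Real.exp Q ≤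
      X * Real.exp (L * (-R - 1)) := by
  -- adapted from `JensenStieltjesMajorant.shortInterval_final` (pieces `≤ X exp(−2L² − 1)` there)
  have hL0 : 0 < L := by linarith
  have hlogL : 0 ≤ Real.log L := Real.log_nonneg (by linarith)
  have hL2sq : 16 ≤ L ^ 2 := by nlinarith
  have hLL : L + 1 ≤ L ^ 2 := by nlinarith
  have hBL : 0 ≤ B * L ^ 2 := by positivity
  -- piece (a): the low part
  have ha : Real.exp (-L ^ 3) * (L ^ 2) ^ K ≤ Real.exp (-4 * L ^ 2 - L - 1) := by
    have hLK : (L ^ 2) ^ K = Real.exp (2 * Real.log L * K) := by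
      rw [← Real.rpow_natCast, Real.rpow_def_of_pos (by positivity), Real.log_pow]
      congr 1
    rw [hLK, ← Real.exp_add, Real.exp_le_exp]
    have hK' : (K : ℝ) ≤ (168 * B + 7) * L ^ 2 := by linarith
    have h1 : 2 * Real.log L * K ≤ 2 * Real.log L * ((168 * B + 7) * L ^ 2) :=
      mul_le_mul_of_nonneg_left hK' (by linarith)
    have h2 : L ^ 2 * ((336 * B + 14) * Real.log L + 5) ≤ L ^ 2 * L :=
      mul_le_mul_of_nonneg_left hAL (by positivity)
    linarith
  -- piece (b): the high part
  have hb : Real.exp (-K) * (2 * X + 1) * Real.exp Q ≤ X * Real.exp (-4 * L ^ 2 - L - 1) := by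
    have h3X : 2 * X + 1 ≤ 3 * X := by linarith
    have hexpQK : Real.exp (-K) * Real.exp Q ≤ Real.exp (-6 * L ^ 2) := by
      rw [← Real.exp_add, Real.exp_le_exp]
      linarith
    have h3 : 3 * Real.exp (-6 * L ^ 2) ≤ Real.exp (-4 * L ^ 2 - L - 1) := by
      have h := Real.add_one_le_exp (2 * L ^ 2 - L - 1)
      have hsplit :
          Real.exp (-4 * L ^ 2 - L - 1) = Real.exp (2 * L ^ 2 - L - 1) * Real.exp (-6 * L ^ 2) := by
        rw [← Real.exp_add]
        congr 1
        ring
      rw [hsplit]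
      apply mul_le_mul_of_nonneg_right _ (Real.exp_pos _).le
      linarith
    calc Real.exp (-K) * (2 * X + 1) * Real.exp Q
        = (2 * X + 1) * (Real.exp (-K) * Real.exp Q) := by ring
      _ ≤ (3 * X) * Real.exp (-6 * L ^ 2) :=
          mul_le_mul h3X hexpQK (by positivity) (by positivity)
      _ = X * (3 * Real.exp (-6 * L ^ 2)) := by ring
      _ ≤ X * Real.exp (-4 * L ^ 2 - L - 1) := mul_le_mul_of_nonneg_left h3 (by linarith)
  -- combine
  have hc : 2 * Real.exp (-4 * L ^ 2 - L - 1) ≤ Real.exp (L * (-R - 1)) := by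
    have h2e : (2 : ℝ) ≤ Real.exp 1 := by
      have := Real.add_one_le_exp (1 : ℝ)
      norm_num at this
      exact this
    calc 2 * Real.exp (-4 * L ^ 2 - L - 1) ≤ Real.exp 1 * Real.exp (-4 * L ^ 2 - L - 1) :=
          mul_le_mul_of_nonneg_right h2e (Real.exp_pos _).le
      _ = Real.exp (-4 * L ^ 2 - L) := by
          rw [← Real.exp_add]
          congr 1
          ring
      _ ≤ Real.exp (L * (-R - 1)) := by
          rw [Real.exp_le_exp]
          nlinarith [mul_le_mul_of_nonneg_left hRL hL0.le]
  calc X * Real.exp (-L ^ 3) * (L ^ 2) ^ K + Real.exp (-K) * (2 * X + 1) * Real.exp Q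
      ≤ X * Real.exp (-4 * L ^ 2 - L - 1) + X * Real.exp (-4 * L ^ 2 - L - 1) := by
        apply add_le_add _ hb
        rw [mul_assoc]
        exact mul_le_mul_of_nonneg_left ha (by linarith)
    _ = X * (2 * Real.exp (-4 * L ^ 2 - L - 1)) := by ring
    _ ≤ X * Real.exp (L * (-R - 1)) := mul_le_mul_of_nonneg_left hc (by linarith)

/-- Pointwise form of the stub with explicit largeness hypotheses: for `x ≥ 3` with
`L = log log x ≥ 4` and `(336B + 14) log L + 5 ≤ L`, and `1 ≤ R ≤ 4L`,
`Σ_{x < n ≤ ⌊x + x e^{−L³}⌋₊} R^{s(n)} ≤ x (log x)^{−R−1}`. -/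
theorem pointwise_wide {B : ℝ} (hB : 0 ≤ B)
    (hyp : ∀ x : ℕ, 3 ≤ x → ∀ y : ℝ, 1 ≤ y →
        ∑ n ∈ Finset.range (x + 1), y ^ (n.factorization.sum fun _ v => min v 2) ≤
          ((x : ℝ) + 1) * Real.exp (B * y * Real.log (Real.log x) + B * y ^ (3 / 2 : ℝ)))
    {x : ℕ} (hx3 : 3 ≤ x) (hL4 : 4 ≤ Real.log (Real.log x))
    (hAL : (336 * B + 14) * Real.log (Real.log (Real.log x)) + 5 ≤ Real.log (Real.log x))
    {R : ℝ} (hR1 : 1 ≤ R) (hRL : R ≤ 4 * Real.log (Real.log x)) :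
    ∑ n ∈ Finset.Ioc x ⌊(x : ℝ) + x * Real.exp (-(Real.log (Real.log x) ^ 3))⌋₊,
        R ^ (n.factorization.sum fun _ v => min v 2) ≤
      (x : ℝ) * Real.log x ^ (-R - 1) := by
  -- adapted from `JensenStieltjesMajorant.shortInterval_pointwise` (range `R ≤ L` there)
  have hX3 : (3 : ℝ) ≤ x := by exact_mod_cast hx3
  have hX0 : (0 : ℝ) < x := by linarith
  have hlogpos : 0 < Real.log (x : ℝ) := Real.log_pos (by linarith)
  have hR0 : 0 ≤ R := by linarith
  rw [Real.rpow_def_of_pos hlogpos]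
  -- notation
  set L : ℝ := Real.log (Real.log (x : ℝ)) with hLdef
  have hL0 : 0 < L := by linarith
  have hRL2 : R ≤ L ^ 2 := by nlinarith
  -- the step `h = x e^{-L^3}`
  have hE1 : Real.exp (-(L ^ 3)) ≤ 1 := by
    rw [Real.exp_le_one_iff]
    have : 0 ≤ L ^ 3 := by positivity
    linarith
  have hh0 : 0 ≤ (x : ℝ) * Real.exp (-(L ^ 3)) := by positivity
  have hhX : (x : ℝ) * Real.exp (-(L ^ 3)) ≤ x := by
    simpa using mul_le_mul_of_nonneg_left hE1 hX0.le
  have hfloor : (⌊(x : ℝ) + x * Real.exp (-(L ^ 3))⌋₊ : ℝ) ≤ (x : ℝ) + x * Real.exp (-(L ^ 3)) :=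
    Nat.floor_le (by positivity)
  set m : ℕ := ⌊(x : ℝ) + x * Real.exp (-(L ^ 3))⌋₊ with hmdef
  -- bounds for `m`
  have hxm : x ≤ m := Nat.le_floor (by linarith)
  have hm2x : m ≤ 2 * x := Nat.floor_le_of_le (by push_cast; linarith)
  have hcard : ((Finset.Ioc x m).card : ℝ) ≤ (x : ℝ) * Real.exp (-(L ^ 3)) := by
    rw [Nat.card_Ioc, Nat.cast_sub hxm]
    linarith
  -- the splitting parameter `K`
  set K : ℕ := ⌈(168 * B + 6) * L ^ 2⌉₊ with hKdef
  have hKlo : (168 * B + 6) * L ^ 2 ≤ K := Nat.le_ceil _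
  have hKhi : (K : ℝ) < (168 * B + 6) * L ^ 2 + 1 := Nat.ceil_lt_add_one (by positivity)
  -- split the sum
  rw [← Finset.sum_filter_add_sum_filter_not (Finset.Ioc x m)
    (fun n => (n.factorization.sum fun _ v => min v 2) ≤ K)]
  -- low part
  have hlow : ∑ n ∈ (Finset.Ioc x m).filter (fun n => (n.factorization.sum fun _ v => min v 2) ≤ K),
      R ^ (n.factorization.sum fun _ v => min v 2) ≤
        (x : ℝ) * Real.exp (-(L ^ 3)) * (L ^ 2) ^ K := by
    refine (shortInterval_low_part _ K hR1).trans ?_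
    exact mul_le_mul hcard (pow_le_pow_left₀ hR0 hRL2 K) (by positivity) hh0
  -- high part
  have hhigh : ∑ n ∈ (Finset.Ioc x m).filter
        (fun n => ¬ (n.factorization.sum fun _ v => min v 2) ≤ K),
      R ^ (n.factorization.sum fun _ v => min v 2) ≤
      Real.exp (-K) * (2 * x + 1) *
        Real.exp (B * (Real.exp 1 * R) * Real.log (Real.log (2 * x)) +
          B * (Real.exp 1 * R) ^ (3 / 2 : ℝ)) := by
    refine (shortInterval_high_part _ K hR0).trans ?_
    rw [mul_assoc]
    refine mul_le_mul_of_nonneg_left ?_ (Real.exp_pos _).le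
    have hsub : Finset.Ioc x m ⊆ Finset.range (2 * x + 1) := by
      intro n hn
      rw [Finset.mem_Ioc] at hn
      rw [Finset.mem_range]
      omega
    have he1 : 1 ≤ Real.exp 1 := Real.one_le_exp zero_le_one
    have heR : 1 ≤ Real.exp 1 * R := one_le_mul_of_one_le_of_one_le he1 hR1
    have h2x : 3 ≤ 2 * x := by omega
    have hmaj := hyp (2 * x) h2x (Real.exp 1 * R) heR
    push_cast at hmaj
    refine le_trans ?_ hmaj
    refine Finset.sum_le_sum_of_subset_of_nonneg hsub ?_
    intro n _ _
    exact pow_nonneg (by linarith) _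
  -- assemble
  have hQ := rankin_exponent_le_wide hB (by linarith : (2:ℝ) ≤ x) hLdef.symm (by linarith) hR1 hRL
  have hfin := final_wide (X := (x : ℝ)) hB hL4 hAL hKlo hKhi hRL (by linarith) hQ
  linarith [hlow, hhigh, hfin]

end ShortIntervalWide

open ShortIntervalWide in
/-- **Stub E3 (de-smoothing, `R ≤ 4 log log x`).**  From the Rankin majorant (the statement of
`JensenStieltjesMajorant.stub_rankinMajorant`, taken as a hypothesis with its constant `B`): there
is `x₁` such that for all natural `x ≥ x₁` and all `1 ≤ R ≤ 4 log log x`, with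
`h = x·e^{−(log log x)³}`, `Σ_{x < n ≤ x + h} R^{s(n)} ≤ x (log x)^{−R−1}`.  The threshold `x₁` is
extracted from the eventual inequalities `log log x ≥ 4`,
`(336B + 14) log log log x + 5 ≤ log log x` (`log u = o(u)`). [MontgomeryVaughan2007, §7.4] -/
theorem stub_shortIntervalWide :
    ∀ B : ℝ, 0 ≤ B →
      (∀ x : ℕ, 3 ≤ x → ∀ y : ℝ, 1 ≤ y →
        ∑ n ∈ Finset.range (x + 1), y ^ (n.factorization.sum fun _ v => min v 2) ≤
          ((x : ℝ) + 1) * Real.exp (B * y * Real.log (Real.log x) + B * y ^ (3 / 2 : ℝ))) →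
      ∃ x₁ : ℕ, ∀ x : ℕ, x₁ ≤ x → ∀ R : ℝ, 1 ≤ R → R ≤ 4 * Real.log (Real.log x) →
        ∑ n ∈ Finset.Ioc x ⌊(x : ℝ) + x * Real.exp (-(Real.log (Real.log x) ^ 3))⌋₊,
            R ^ (n.factorization.sum fun _ v => min v 2) ≤
          (x : ℝ) * Real.log x ^ (-R - 1) := by
  intro B hB hyp
  -- adapted from `JensenStieltjesMajorant.stub_shortIntervalCapped`:
  -- `log u = o(u)` gives the eventual inequality `(336B + 14) log u + 5 ≤ u`.
  have hE : ∀ᶠ u : ℝ in atTop, 4 ≤ u ∧ (336 * B + 14) * Real.log u + 5 ≤ u := by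
    have hA : (0 : ℝ) < 336 * B + 14 := by linarith
    have hA' : (336 * B + 14 : ℝ) ≠ 0 := hA.ne'
    have h := Asymptotics.isLittleO_iff.mp Real.isLittleO_log_id_atTop
      (show (0 : ℝ) < 1 / (2 * (336 * B + 14)) by positivity)
    filter_upwards [h, eventually_ge_atTop (10 : ℝ)] with u h1 hu10
    rw [Real.norm_eq_abs, Real.norm_eq_abs, id_eq,
      abs_of_nonneg (Real.log_nonneg (by linarith : (1 : ℝ) ≤ u)),
      abs_of_nonneg (by linarith : (0 : ℝ) ≤ u)] at h1
    refine ⟨by linarith, ?_⟩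
    have h2 : (336 * B + 14) * Real.log u ≤ u / 2 := by
      calc (336 * B + 14) * Real.log u ≤ (336 * B + 14) * (1 / (2 * (336 * B + 14)) * u) :=
            mul_le_mul_of_nonneg_left h1 hA.le
        _ = u / 2 := by
            field_simp
    linarith
  have hT : Tendsto (fun x : ℕ => Real.log (Real.log (x : ℝ))) atTop atTop :=
    Real.tendsto_log_atTop.comp (Real.tendsto_log_atTop.comp tendsto_natCast_atTop_atTop)
  obtain ⟨x₁, hx₁⟩ := Filter.eventually_atTop.1 ((hT.eventually hE).and (eventually_ge_atTop 3))
  refine ⟨x₁, fun x hx R hR1 hRL => ?_⟩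
  obtain ⟨⟨hL4, hAL⟩, hx3⟩ := hx₁ x hx
  exact pointwise_wide hB hyp hx3 hL4 hAL hR1 hRL

end Summit.Parity.BatemanHorn.Cruxes.DiscMajorantLog.Sketch

end
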